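import Summits.Parity.GeneralizedHardyLittlewood.Theorems.LiouvilleShiftedTablesTypeI2DilatedURB1
import Summits.Parity.GeneralizedHardyLittlewood.Theorems.TypeI2Dilated.Negative.LogPowerBias
import Literature.NumberTheory.Sieve.DivisorBound

/-!
# The `𝔲_R` terms of the assembly (`stub_uRBound`), file 7: numerics of the Type I bound

Route `LiouvilleShiftedTables` (Parity / GeneralizedHardyLittlewood), crux `TypeI2Dilated` (stmt-Parity-14272), line
`peel-to-drappeau`, registered stub `stub_uRBound : URBound`; continuation of `…URB1`–`…URB6` (imports only `…URB1`: no chain lemma is used).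

Pure real-variable inequalities feeding the application of `Literature…DrappeauTypeI.typeI_core` in the next file
(parameters `x_F = 2x/ν`, `V_min = x^{1/3−1/50}`, `G₀ = ⌈x^{120ρ}⌉`, `H = ⌈x^{500ρ}⌉`, `L = qrP ≤ x^{5ρ}`, `Rd = x^{40ρ}`,
`Z = x³`, `Dv = x^ρ`, `1 ≤ ν ≤ x^{3/100}`, `k ≤ 2`):

* `typeI_numerics` — with `(G₀L)^{k+1} ≤ 8x^{375ρ}`, `H^k ≤ 4x^{1000ρ}`, `L^{C₀} ≤ x^{5C₀ρ}`,
  `x_F^{1−δ} ≤ 2x^{1−97d/100}/ν`, `kY/(νH) ≤ 4x^{1−500ρ}/ν`, `2^k x_F G₀/V_min ≤ 16 x^{1+120ρ−47/150}/ν`,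
  `Φ, Ψ, Ψ₁ ≤ x^ρ`, `∏ 2Wₜ ≤ 16x/ν`, `(τ(L)²)^{k+1} ≤ x^{6ρ}`, `G₀^{−1/2} ≤ x^{−60ρ}` and
  `ρ (2000 + 10C₀) ≤ d ≤ 1/2`, `ρ ≤ 1/6000`, the right side of `typeI_core` is `≤ 100 x^{1−13ρ}/ν ≤ x^{1−12ρ}/ν`;
* the parameter facts `rpow_one_sub_le_of` (`x_F^{1−δ}`), `le_xF_rpow_theta` (`x^{1/2+ρ} ≤ x_F^{1/2+1/85}`),
  `ceil_rpow_bounds`, `sigma_le_rpow_of` (`τ(n) ≤ x^ρ` for `n ≤ x³` via the divisor bound), `pow_rpow_eq`.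
[this line: Lines/peel-to-drappeau.md; cite: Drappeau2017, §6.2]
-/

noncomputable section

namespace Summit.Parity.GeneralizedHardyLittlewood.Cruxes.TypeI2Dilated.PeelToDrappeau

open Finset Fintype Real Filter
open scoped ArithmeticFunction.sigma Classical
open Literature.NumberTheory.Sieve

/-! ### Powers -/

/-- `(x^a)^n = x^{n a}` for `x ≥ 0`. [folklore] -/
theorem pow_rpow_eq {x : ℝ} (hx : 0 ≤ x) (a : ℝ) (n : ℕ) : (x ^ a) ^ n = x ^ ((n : ℝ) * a) := by
  rw [← Real.rpow_natCast (x ^ a) n, ← Real.rpow_mul hx, mul_comm]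

/-- Bounds for `⌈x^a⌉₊`, `x ≥ 1`, `a ≥ 0`: `x^a ≤ ⌈x^a⌉ ≤ 2x^a` and `1 ≤ ⌈x^a⌉`. [folklore] -/
theorem ceil_rpow_bounds {x : ℝ} (hx : 1 ≤ x) {a : ℝ} (ha : 0 ≤ a) :
    1 ≤ ⌈x ^ a⌉₊ ∧ x ^ a ≤ (⌈x ^ a⌉₊ : ℝ) ∧ (⌈x ^ a⌉₊ : ℝ) ≤ 2 * x ^ a := by
  have h1 : 1 ≤ x ^ a := Real.one_le_rpow hx ha
  have h2 := Nat.ceil_lt_add_one (by linarith : 0 ≤ x ^ a)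
  refine ⟨Nat.one_le_iff_ne_zero.2 (Nat.pos_iff_ne_zero.1 (Nat.ceil_pos.2 (by linarith))), Nat.le_ceil _, by linarith⟩

/-! ### The numerics of `typeI_core` -/

/-- **The numerics of the Type I bound**: the right side of `typeI_core`, with every parameter replaced by its monomial
bound, is at most `x^{1−12ρ}/ν` (see the module docstring for the list of bounds). [this line] -/
theorem typeI_numerics {x ρ d C C₀ ν GLk Hk LC XF Φ A2 A3 Dv RD2 Ψ K1 PW TL GH Rd Ψ₁ : ℝ}
    (hx1 : 1 ≤ x) (hν0 : 0 < ν) (hρ : 0 < ρ) (hρ1 : ρ ≤ 1 / 6000) (hC₀ : 0 ≤ C₀) (hρd : ρ * (2000 + 10 * C₀) ≤ d)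
    (e1 : 64 * C ≤ x ^ (7 * d / 100)) (e2 : (64 : ℝ) ≤ x ^ (111 * ρ)) (e3 : (256 : ℝ) ≤ x ^ (1 / 5 : ℝ))
    (e4 : (100 : ℝ) ≤ x ^ ρ)
    (hHk0 : 0 ≤ Hk) (hC : 0 ≤ C) (hLC0 : 0 ≤ LC) (hXF0 : 0 ≤ XF) (hΦ0 : 0 ≤ Φ) (hA20 : 0 ≤ A2)
    (hA30 : 0 ≤ A3) (hΨ0 : 0 ≤ Ψ) (hPW0 : 0 ≤ PW) (hTL0 : 0 ≤ TL) (hGH0 : 0 ≤ GH) (hΨ₁0 : 0 ≤ Ψ₁)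
    (hGLk : GLk ≤ 8 * x ^ (375 * ρ)) (hHk : Hk ≤ 4 * x ^ (1000 * ρ)) (hLC : LC ≤ x ^ (5 * C₀ * ρ))
    (hXF : XF ≤ 2 * x ^ (1 - 97 * d / 100) / ν) (hΦ : Φ ≤ x ^ ρ) (hA2 : A2 ≤ 4 * x ^ (1 - 500 * ρ) / ν)
    (hA3 : A3 ≤ 16 * x ^ (1 + 120 * ρ - (1 / 3 - 1 / 50)) / ν) (hDv : Dv = x ^ ρ) (hRD2 : RD2 = x ^ (80 * ρ))
    (hΨ : Ψ ≤ x ^ ρ) (hK1 : K1 ≤ 3) (hPW : PW ≤ 16 * x / ν) (hTL : TL ≤ x ^ (6 * ρ)) (hGH : GH ≤ x ^ (-(60 * ρ)))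
    (hRd : Rd = x ^ (40 * ρ)) (hΨ₁ : Ψ₁ ≤ x ^ ρ) :
    GLk * (Hk * (C * LC * XF) * Φ + (A2 + A3) * (Dv + Φ) + RD2 * A3 * Ψ) + K1 * PW * TL * GH * (Dv + Rd * Ψ₁) ≤
      x ^ (1 - 12 * ρ) / ν := by
  have hx0 : 0 < x := by linarith
  have hmul : ∀ a b : ℝ, x ^ a * x ^ b = x ^ (a + b) := fun a b => (Real.rpow_add hx0 a b).symm
  have hexp : ∀ {a b : ℝ}, a ≤ b → x ^ a ≤ x ^ b := fun h => Real.rpow_le_rpow_of_exponent_le hx1 h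
  have hxpos : ∀ a : ℝ, 0 < x ^ a := fun a => Real.rpow_pos_of_pos hx0 a
  subst hDv hRD2 hRd
  have hDΦ : x ^ ρ + Φ ≤ 2 * x ^ ρ := by linarith
  have hDΨ : x ^ ρ + x ^ (40 * ρ) * Ψ₁ ≤ 2 * x ^ (41 * ρ) := by
    have h1 : x ^ ρ ≤ x ^ (41 * ρ) := hexp (by linarith)
    have h2 : x ^ (40 * ρ) * Ψ₁ ≤ x ^ (40 * ρ) * x ^ ρ := mul_le_mul_of_nonneg_left hΨ₁ (hxpos _).le
    have h3 : x ^ (40 * ρ) * x ^ ρ = x ^ (41 * ρ) := by rw [hmul]; ring_nf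
    linarith
  set M : ℝ := x ^ (1 - 13 * ρ) / ν with hM
  have hT1 : GLk * (Hk * (C * LC * XF) * Φ) ≤ M := by
    calc _ ≤ (8 * x ^ (375 * ρ)) * ((4 * x ^ (1000 * ρ)) * (C * x ^ (5 * C₀ * ρ) * (2 * x ^ (1 - 97 * d / 100) / ν))
          * x ^ ρ) := by gcongr
      _ = 64 * C * (x ^ (375 * ρ) * x ^ (1000 * ρ) * x ^ (5 * C₀ * ρ) * x ^ (1 - 97 * d / 100) * x ^ ρ) / ν := by
          ring
      _ = 64 * C * x ^ ((1376 + 5 * C₀) * ρ + 1 - 97 * d / 100) / ν := by rw [hmul, hmul, hmul, hmul]; ring_nf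
      _ ≤ x ^ (7 * d / 100) * x ^ ((1376 + 5 * C₀) * ρ + 1 - 97 * d / 100) / ν := by gcongr
      _ ≤ M := by
          rw [hM, hmul]
          refine div_le_div_of_nonneg_right (hexp ?_) hν0.le
          nlinarith
  have hT2 : GLk * (A2 * (x ^ ρ + Φ)) ≤ M := by
    calc _ ≤ (8 * x ^ (375 * ρ)) * ((4 * x ^ (1 - 500 * ρ) / ν) * (2 * x ^ ρ)) := by gcongr
      _ = 64 * (x ^ (375 * ρ) * x ^ (1 - 500 * ρ) * x ^ ρ) / ν := by ring
      _ = 64 * x ^ (1 - 124 * ρ) / ν := by rw [hmul, hmul]; ring_nf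
      _ ≤ x ^ (111 * ρ) * x ^ (1 - 124 * ρ) / ν := by gcongr
      _ = M := by rw [hM, hmul]; ring_nf
  have hT3 : GLk * (A3 * (x ^ ρ + Φ)) ≤ M := by
    calc _ ≤ (8 * x ^ (375 * ρ)) * ((16 * x ^ (1 + 120 * ρ - (1 / 3 - 1 / 50)) / ν) * (2 * x ^ ρ)) := by gcongr
      _ = 256 * (x ^ (375 * ρ) * x ^ (1 + 120 * ρ - (1 / 3 - 1 / 50)) * x ^ ρ) / ν := by ring
      _ = 256 * x ^ (1 + 496 * ρ - (1 / 3 - 1 / 50)) / ν := by rw [hmul, hmul]; ring_nf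
      _ ≤ x ^ (1 / 5 : ℝ) * x ^ (1 + 496 * ρ - (1 / 3 - 1 / 50)) / ν := by gcongr
      _ ≤ M := by
          rw [hM, hmul]
          exact div_le_div_of_nonneg_right (hexp (by norm_num; linarith)) hν0.le
  have hT4 : GLk * (x ^ (80 * ρ) * A3 * Ψ) ≤ M := by
    calc _ ≤ (8 * x ^ (375 * ρ)) * (x ^ (80 * ρ) * (16 * x ^ (1 + 120 * ρ - (1 / 3 - 1 / 50)) / ν) * x ^ ρ) := by
          gcongr
      _ = 128 * (x ^ (375 * ρ) * x ^ (80 * ρ) * x ^ (1 + 120 * ρ - (1 / 3 - 1 / 50)) * x ^ ρ) / ν := by ring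
      _ = 128 * x ^ (1 + 576 * ρ - (1 / 3 - 1 / 50)) / ν := by rw [hmul, hmul, hmul]; ring_nf
      _ ≤ x ^ (1 / 5 : ℝ) * x ^ (1 + 576 * ρ - (1 / 3 - 1 / 50)) / ν := by gcongr; linarith
      _ ≤ M := by
          rw [hM, hmul]
          exact div_le_div_of_nonneg_right (hexp (by norm_num; linarith)) hν0.le
  have hPW' : PW ≤ 16 * x ^ (1 : ℝ) / ν := by rwa [Real.rpow_one]
  have hT5 : K1 * PW * TL * GH * (x ^ ρ + x ^ (40 * ρ) * Ψ₁) ≤ 96 * M := by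
    calc _ ≤ 3 * (16 * x ^ (1 : ℝ) / ν) * x ^ (6 * ρ) * x ^ (-(60 * ρ)) * (2 * x ^ (41 * ρ)) := by gcongr
      _ = 96 * ((x ^ (1 : ℝ) * x ^ (6 * ρ)) * x ^ (-(60 * ρ)) * x ^ (41 * ρ)) / ν := by ring
      _ = 96 * M := by rw [hM, hmul, hmul, hmul]; ring_nf
  have hsplit : GLk * (Hk * (C * LC * XF) * Φ + (A2 + A3) * (x ^ ρ + Φ) + x ^ (80 * ρ) * A3 * Ψ) +
      K1 * PW * TL * GH * (x ^ ρ + x ^ (40 * ρ) * Ψ₁) =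
      GLk * (Hk * (C * LC * XF) * Φ) + GLk * (A2 * (x ^ ρ + Φ)) + GLk * (A3 * (x ^ ρ + Φ)) +
        GLk * (x ^ (80 * ρ) * A3 * Ψ) + K1 * PW * TL * GH * (x ^ ρ + x ^ (40 * ρ) * Ψ₁) := by ring
  rw [hsplit]
  calc _ ≤ M + M + M + M + 96 * M := by linarith
    _ = 100 * x ^ (1 - 13 * ρ) / ν := by rw [hM]; ring
    _ ≤ x ^ ρ * x ^ (1 - 13 * ρ) / ν := by gcongr
    _ = x ^ (1 - 12 * ρ) / ν := by rw [hmul]; ring_nf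

/-! ### Parameter facts -/

/-- `x_F^{1−δ} ≤ 2x^{1−97d/100}/ν` for `x_F = 2x/ν`, `d ≤ δ`, `0 < d`, `1 ≤ ν ≤ x^{3/100}`. [this line] -/
theorem rpow_one_sub_le_of {x ν δ d : ℝ} (hx1 : 1 ≤ x) (hν1 : 1 ≤ ν) (hνle : ν ≤ x ^ (3 / 100 : ℝ)) (hd0 : 0 < d)
    (hdδ : d ≤ δ) : (2 * x / ν) ^ (1 - δ) ≤ 2 * x ^ (1 - 97 * d / 100) / ν := by
  have hx0 : 0 < x := by linarith
  have hν0 : 0 < ν := by linarith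
  have hmul : ∀ a b : ℝ, x ^ a * x ^ b = x ^ (a + b) := fun a b => (Real.rpow_add hx0 a b).symm
  have hxpos : ∀ a : ℝ, 0 < x ^ a := fun a => Real.rpow_pos_of_pos hx0 a
  set xF : ℝ := 2 * x / ν with hxF
  have hxF1 : 1 ≤ xF := by
    rw [hxF, le_div_iff₀ hν0, one_mul]
    calc ν ≤ x ^ (3 / 100 : ℝ) := hνle
      _ ≤ x ^ (1 : ℝ) := Real.rpow_le_rpow_of_exponent_le hx1 (by norm_num)
      _ = x := Real.rpow_one x
      _ ≤ 2 * x := by linarith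
  have hxF0 : 0 < xF := by linarith
  have h1 : xF ^ (1 - δ) ≤ xF ^ (1 - d) := Real.rpow_le_rpow_of_exponent_le hxF1 (by linarith)
  have h2 : xF ^ (1 - d) = xF * (xF⁻¹) ^ d := by
    rw [Real.rpow_sub hxF0, Real.rpow_one, Real.inv_rpow hxF0.le, div_eq_mul_inv]
  have h3 : xF⁻¹ ≤ x ^ (-(97 / 100 : ℝ)) := by
    rw [hxF, inv_div]
    calc ν / (2 * x) ≤ x ^ (3 / 100 : ℝ) / x := by
          rw [div_le_div_iff₀ (by linarith) hx0]
          nlinarith [mul_le_mul_of_nonneg_right hνle hx0.le, hxpos (3 / 100 : ℝ)]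
      _ = x ^ ((3 / 100 : ℝ) - 1) := (Real.rpow_sub_one hx0.ne' _).symm
      _ = x ^ (-(97 / 100 : ℝ)) := by norm_num
  have h4 : (xF⁻¹) ^ d ≤ x ^ (-(97 * d / 100)) := by
    calc (xF⁻¹) ^ d ≤ (x ^ (-(97 / 100 : ℝ))) ^ d := Real.rpow_le_rpow (by positivity) h3 hd0.le
      _ = x ^ (-(97 * d / 100)) := by rw [← Real.rpow_mul hx0.le]; ring_nf
  calc xF ^ (1 - δ) ≤ xF * (xF⁻¹) ^ d := h1.trans (le_of_eq h2)
    _ ≤ (2 * x / ν) * x ^ (-(97 * d / 100)) := mul_le_mul_of_nonneg_left h4 hxF0.le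
    _ = 2 * (x ^ (1 : ℝ) * x ^ (-(97 * d / 100))) / ν := by rw [Real.rpow_one]; ring
    _ = 2 * x ^ (1 - 97 * d / 100) / ν := by rw [hmul]; ring_nf

/-- `x^{1/2+ρ} ≤ x_F^{1/2+1/85}` for `x_F = 2x/ν`, `ν ≤ 2^8 x^{1/50}`, `ρ ≤ 1/6000`, `16 ≤ x^{1/1000}`:
indeed `x_F ≥ x^{49/50}/2^7`, `(2^7)^{1/2+1/85} ≤ 16` and `1/2 + ρ + 1/1000 ≤ (49/50)(1/2 + 1/85)`. [this line] -/
theorem le_xF_rpow_theta {x ν ρ : ℝ} (hx1 : 1 ≤ x) (hν0 : 0 < ν) (hνle : ν ≤ (2 : ℝ) ^ 8 * x ^ (1 / 50 : ℝ))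
    (hρ1 : ρ ≤ 1 / 6000) (e : (16 : ℝ) ≤ x ^ (1 / 1000 : ℝ)) :
    x ^ (1 / 2 + ρ) ≤ (2 * x / ν) ^ (1 / 2 + 1 / 85 : ℝ) := by
  have hx0 : 0 < x := by linarith
  have hB : x ^ (49 / 50 : ℝ) / 2 ^ 7 ≤ 2 * x / ν := by
    rw [div_le_div_iff₀ (by positivity) hν0]
    calc x ^ (49 / 50 : ℝ) * ν ≤ x ^ (49 / 50 : ℝ) * ((2 : ℝ) ^ 8 * x ^ (1 / 50 : ℝ)) :=
          mul_le_mul_of_nonneg_left hνle (Real.rpow_nonneg hx0.le _)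
      _ = 2 ^ 7 * (2 * (x ^ (49 / 50 : ℝ) * x ^ (1 / 50 : ℝ))) := by ring
      _ = 2 * x * 2 ^ 7 := by rw [← Real.rpow_add hx0]; norm_num; ring
  have h1 : (x ^ (49 / 50 : ℝ) / 2 ^ 7) ^ (1 / 2 + 1 / 85 : ℝ) ≤ (2 * x / ν) ^ (1 / 2 + 1 / 85 : ℝ) :=
    Real.rpow_le_rpow (by positivity) hB (by norm_num)
  have h2 : (x ^ (49 / 50 : ℝ) / 2 ^ 7) ^ (1 / 2 + 1 / 85 : ℝ) =
      x ^ ((49 / 50 : ℝ) * (1 / 2 + 1 / 85)) / ((2 : ℝ) ^ 7) ^ (1 / 2 + 1 / 85 : ℝ) := by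
    rw [Real.div_rpow (Real.rpow_nonneg hx0.le _) (by positivity), ← Real.rpow_mul hx0.le]
  have h3 : ((2 : ℝ) ^ 7) ^ (1 / 2 + 1 / 85 : ℝ) ≤ 16 := by
    rw [← Real.rpow_natCast 2 7, ← Real.rpow_mul (by norm_num)]
    calc (2 : ℝ) ^ (((7 : ℕ) : ℝ) * (1 / 2 + 1 / 85 : ℝ)) ≤ 2 ^ (4 : ℝ) :=
          Real.rpow_le_rpow_of_exponent_le (by norm_num) (by norm_num)
      _ = 16 := by norm_num
  have h4 : x ^ ((49 / 50 : ℝ) * (1 / 2 + 1 / 85)) / 16 ≤ (2 * x / ν) ^ (1 / 2 + 1 / 85 : ℝ) := by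
    refine le_trans ?_ (le_of_eq_of_le h2.symm h1)
    exact div_le_div_of_nonneg_left (Real.rpow_nonneg hx0.le _) (by positivity) h3
  refine le_trans ?_ h4
  rw [le_div_iff₀ (by norm_num)]
  calc x ^ (1 / 2 + ρ) * 16 ≤ x ^ (1 / 2 + ρ) * x ^ (1 / 1000 : ℝ) :=
        mul_le_mul_of_nonneg_left e (Real.rpow_nonneg hx0.le _)
    _ = x ^ (1 / 2 + ρ + 1 / 1000) := by rw [← Real.rpow_add hx0]
    _ ≤ _ := Real.rpow_le_rpow_of_exponent_le hx1 (by norm_num; linarith)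

/-- The divisor bound as used here: if `τ(n) ≤ C_τ n^{ρ/6}` for all `n` and `C_τ ≤ x^{ρ/2}`, then `τ(n) ≤ x^ρ` for
`n ≤ x³`. [folklore] -/
theorem sigma_le_rpow_of {x ρ Cτ : ℝ} (hx0 : 0 < x) (hρ : 0 ≤ ρ)
    (hCτ : ∀ n : ℕ, ((σ 0 n : ℕ) : ℝ) ≤ Cτ * (n : ℝ) ^ (ρ / 6)) (e : Cτ ≤ x ^ (ρ / 2)) {n : ℕ}
    (hn : (n : ℝ) ≤ x ^ (3 : ℝ)) : ((σ 0 n : ℕ) : ℝ) ≤ x ^ ρ := by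
  have hC0 : 0 ≤ Cτ := by
    have := hCτ 1
    rw [Nat.cast_one, Real.one_rpow, mul_one] at this
    exact le_trans (Nat.cast_nonneg _) this
  calc ((σ 0 n : ℕ) : ℝ) ≤ Cτ * (n : ℝ) ^ (ρ / 6) := hCτ n
    _ ≤ Cτ * (x ^ (3 : ℝ)) ^ (ρ / 6) := mul_le_mul_of_nonneg_left (Real.rpow_le_rpow (Nat.cast_nonneg _) hn (by linarith)) hC0
    _ = Cτ * x ^ (ρ / 2) := by rw [← Real.rpow_mul hx0.le]; ring_nf
    _ ≤ x ^ (ρ / 2) * x ^ (ρ / 2) := mul_le_mul_of_nonneg_right e (Real.rpow_nonneg hx0.le _)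
    _ = x ^ ρ := by rw [← Real.rpow_add hx0]; ring_nf

/-- Landing anchor of the `𝔲_R`-bound chain, file 7; registered stub `urbChain7_anchor` of the crux item (the
mathematical content of this file is `typeI_numerics`). -/
theorem urbChain7_anchor : True := trivial

end Summit.Parity.GeneralizedHardyLittlewood.Cruxes.TypeI2Dilated.PeelToDrappeau

end
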